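import Summits.FinalStateConjecture.FinalStateConjecture.Theses.EIHFluxBalance

/-!
# S2 `stub_windowFluxLaw` — census of the missing inputs (scratch, NOT proposed)

Worker scratch for the line lead: the typed shapes of the first missing named facts behind
`stub_windowFluxLaw` (line `old-light-leaves-the-cone`, crux stmt-FinalStateConjecture-10166).
Verdict: `stub-blocked: LLBalanceLaw (stmt-FinalStateConjecture-10189)` — clause (iv) below is the
first unproved input; (M2)–(M3) are further untyped-in-the-tree inputs; the pseudotensor bound and
the moving-sphere law are the sibling line's registered `stub_pseudotensorBound` /
`stub_windowCharges` (`Cruxes/InertialRecession/Lines/sublinear-is-free-clean-window-charges.lean`).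
-/

set_option linter.dupNamespace false

noncomputable section

namespace Summit.FinalStateConjecture.FinalStateConjecture.Cruxes.InertialRecession.OldLightLeavesTheCone.S2Census

open scoped BigOperators Topology Manifold Classical MeasureTheory Matrix InnerProductSpace ContDiff ENNReal
open Filter Set Function TopologicalSpace MeasureTheory Literature.Geometry.Lorentzian
open Summit.FinalStateConjecture.FinalStateConjecture.Theses.EIHFluxBalance

/-- (M1) = clause (iv) of route support `LLBalanceLaw` (stmt-FinalStateConjecture-10189), UNPROVED
(clauses (i)–(iii),(v) landed: `Theorems.EIHFluxBalanceLLBalanceLawIdentities`, `…LLShellFormula`;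
tools for (iv): `LLSphere.hasDerivAt_setIntegral_sphere`, `…LLSphericalChart`; missing: Stokes for the
exact 2-form `Σ_l ∂_l h^{μjl}` on the `μHE[2]`-sphere). -/
def FixedSphereBalance : Prop :=
  ∀ (g : E4 → E4 →L[ℝ] E4 →L[ℝ] ℝ) (U : Set E4), IsOpen U → ContDiffOn ℝ (⊤ : ℕ∞) g U →
    (∀ x ∈ U, ∀ v w : E4, g x v w = g x w v) → (∀ x ∈ U, LandauLifshitz.metricDet g x < 0) →
    ∀ (t R : ℝ) (ξ : E3), 0 < R → (∀ y ∈ Metric.sphere ξ R, E4.ofTimeSpace t y ∈ U) →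
    (∀ x ∈ U, MetricCoord.ricAt g x = 0) → ∀ μ : Fin 4,
    HasDerivAt (fun s ↦ LandauLifshitz.quasiLocalMomentum g s ξ R μ)
      (-LandauLifshitz.momentumFlux g t ξ R μ) t

/-- (M2) Vacuum shell Gauss law with `μHE[2]` boundary terms: `P(S') − P(S) = ∫_shell (−g) t^{μ0}_LL`
(`∂_j h^{μ0j} = emComplex^{μ0} = (−g)t^{μ0}` in vacuum; divergence theorem on a region bounded by two
coordinate spheres — not in Mathlib (boxes only) nor in the tree (`E4.ballIntegral_sub_eq_integral_divergence`
is for compactly supported currents)). Needed to move/resize windows (Lipschitz paths) and for additivity. -/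
def ShellGaussLaw : Prop :=
  ∀ (g : E4 → E4 →L[ℝ] E4 →L[ℝ] ℝ) (U : Set E4), IsOpen U → ContDiffOn ℝ (⊤ : ℕ∞) g U →
    (∀ x ∈ U, ∀ v w : E4, g x v w = g x w v) → (∀ x ∈ U, LandauLifshitz.metricDet g x < 0) →
    (∀ x ∈ U, MetricCoord.ricAt g x = 0) →
    ∀ (t : ℝ) (ξ ξ' : E3) (R R' : ℝ), 0 < R → Metric.closedBall ξ R ⊆ Metric.ball ξ' R' →
    (∀ y ∈ Metric.closedBall ξ' R' \ Metric.ball ξ R, E4.ofTimeSpace t y ∈ U) → ∀ μ : Fin 4,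
    LandauLifshitz.quasiLocalMomentum g t ξ' R' μ - LandauLifshitz.quasiLocalMomentum g t ξ R μ =
      ∫ y in Metric.closedBall ξ' R' \ Metric.ball ξ R,
        -LandauLifshitz.metricDet g (E4.ofTimeSpace t y) *
          LandauLifshitz.pseudotensor g (E4.ofTimeSpace t y) μ 0

/-- (M3) Ricci bridge for the lab component field `B.bilin + deviationExtend B Φ` (= `Φ^* g` on `U`):
smooth and Ricci-flat in the sense of `MetricCoord.ricAt` wherever it is nondegenerate, from `𝓢`
vacuum and `Φ` smooth (nondegeneracy of the pullback forces `dΦ` invertible, so `Φ` is a local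
isometry there; then `OpensChart.ricci_eq_ricAt`). Not in the tree. -/
def LabRicciBridge : Prop :=
  ∀ (𝓢 : Spacetime.{0} 4) (B : ModelBackground) (Φ : B.domain → 𝓢.carrier) (W : Set E4),
    (∀ [𝓢.metric.toPseudoRiemannianMetric.HasLeviCivita],
      𝓢.metric.toPseudoRiemannianMetric.IsRicciFlat) →
    ContMDiff 𝓘(ℝ, E4) (𝓡 4) ((⊤ : ℕ∞) : WithTop ℕ∞) Φ → IsOpen W → W ⊆ (B.domain : Set E4) →
    ContDiffOn ℝ ((⊤ : ℕ∞) : WithTop ℕ∞) B.bilin W →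
    (∀ x ∈ W, LandauLifshitz.metricDet (fun y ↦ B.bilin y + 𝓢.deviationExtend B Φ y) x ≠ 0) →
    ContDiffOn ℝ ((⊤ : ℕ∞) : WithTop ℕ∞) (fun y ↦ B.bilin y + 𝓢.deviationExtend B Φ y) W ∧
      ∀ x ∈ W, MetricCoord.ricAt (fun y ↦ B.bilin y + 𝓢.deviationExtend B Φ y) x = 0

end Summit.FinalStateConjecture.FinalStateConjecture.Cruxes.InertialRecession.OldLightLeavesTheCone.S2Census

end
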